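import Summits.BirchSwinnertonDyer.BirchSwinnertonDyer.Theorems.GoldfeldK12AdditiveTwoRamifiedHeegner
import Literature.NumberTheory.EllipticCurves.Kriz2021.AnticyclotomicPAdicLFunctionProofs
import HarnessLib

set_option linter.dupNamespace false -- namespace `…BirchSwinnertonDyer.BirchSwinnertonDyer…` is the cell's (D-0017 nested layout)
set_option autoImplicit false

/-!
# Crux K12₂″ (item 20044) over the `2`-RAMIFIED Heegner fields of `X₀(49)`: the Heegner sub-leaf
# `X049HeegnerNonTorsionEvenDiscr` CONSUMES Kriz 2021 Thm. 9.10 (typed fact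
# `Kriz2021.thm910_exists_anticyclotomicLFunction`, seat ty-2) — the two-line consumer, its CONVERSE, and
# what the pair says about the line «kriz-ramified»

Cell `bsd-goldfeld`, prover seat `bsd-goldfeld-s1p-c201` (gen 5), `--supports stmt-BirchSwinnertonDyer-20044`
(route decl `…Theses.GoldfeldAllTwistsTwoConverse.RankOneTwoConverseCMSevenAdditiveTwo`, K12₂″). TARGET v4 §2
c201 (c). The item is OPEN mathematics; NOTHING HERE PROVES IT. THEOREMS ONLY: no definition, no new fact,
no `sorry`.

## What is typed upstream

* The Heegner sub-leaf (c201 g4, `GoldfeldK12AdditiveTwoRamifiedHeegner`, p443153):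
  `X049HeegnerNonTorsionEvenDiscr` — for `K` imaginary quadratic with `4 ∣ d_K` (`2` ramified) and `7` split
  (classical Heegner hypothesis for `N = 49`): `corank_{ℤ₂} Sel_{2^∞}(X₀(49)/K) = 1 ⟹` every level-`49`
  Heegner point `P_K ∈ X₀(49)(K)` has infinite order. The crux BY NAME follows from it plus the `7`-non-split
  half (`rankOneTwoConverseCMSevenAdditiveTwo_of_heegnerNonTorsion_of_nonHeegnerHalf`).
* The frame fact (ty-2, `Literature/…/Kriz2021/AnticyclotomicPAdicLFunction.lean`, landed 2026-08-26):
  `Kriz2021.thm910_exists_anticyclotomicLFunction` — for the newform `f` of `W`, `p ∤ N_W ≥ 4`, `K` imaginary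
  quadratic with ONE prime above `p` and the strict Heegner hypothesis, SOME `𝓛 : HeckeCharacter K → ℂ_p`
  satisfies `Kriz2021.IsAnticyclotomicLFunction N W f p K 𝓛`: (C) continuity (Thm. 8.9), (V) vanishing
  dictionary at ODD `d_K` (Thm. 8.14), (W→) `𝓛 1 ≠ 0 ⟹` Heegner points non-torsion, (W←) a non-torsion
  Heegner point `⟹ 𝓛 1 ≠ 0` (Thm. 9.10: `𝓛_{p,α}(f, 𝐍̌_K) = Ω(A,t)·Ξ_p·log_w P_K`, `Ξ₂(f₄₉) = 1/2`); its
  `p = 2`, `4 ∣ d_K` specialisation `….two_of_four_dvd_discr` (companion proofs file: `4 ∣ d_K ⟹` one prime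
  above `2`, Marcus Ch. 3 Thm. 25).

## What this file proves

§1 `exists_isNewformOf_cm7_level_fortyNine` — Modularity read at level `49` (`N(X₀(49)) = 49`, tree theorem
`conductorNorm_cm7`; transport of the level in the type of the cusp form), and
`exists_krizLFunction_cm7_of_four_dvd_discr` — AT EVERY `K` of the sub-leaf (imaginary quadratic, `4 ∣ d_K`,
`7` split) Kriz's frame for `(f₄₉, p = 2, K)` EXISTS (`49 ≥ 4`, `2 ∤ 49`): the analytic object of the line
«kriz-ramified» is available in the kernel, not just in the memo.

§2 THE CONSUMER `heegnerNonTorsionEvenDiscr_of_kriz_of_krizValue_ne_zero (hnf) (hKriz) (hALG)`: the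
sub-leaf from Modularity, the Kriz fact, and the ALGEBRAIC arrow
  (ALG) `∀ K` (imaginary quadratic, `4 ∣ d_K`, `7` split) `∀ f` (newform of `X₀(49)`) `∀ 𝓛` (a Kriz frame for
        `(49, X₀(49), f, 2, K)`), `corank_{ℤ₂} Sel_{2^∞}(X₀(49)/K) = 1 ⟹ 𝓛(𝐍̌_K) ≠ 0`
— written INLINE as the binder `hALG` (it is the candidate `stub_alg` of the documented alternative line
`ROUTE-S1PLUS/lines-g10/K12pp_line_kriz_ramified.lean`; no `def` is introduced, see §3 for why), and the crux
BY NAME from (hnf, h12, hGZ, hHP, hKriz, hALG, the `7`-non-split half):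
`rankOneTwoConverseCMSevenAdditiveTwo_of_kriz_of_krizValue_ne_zero_of_nonHeegnerHalf`.

§3 THE CONVERSE `krizValue_ne_zero_of_heegnerNonTorsionEvenDiscr (hHP) (hNT) : (ALG)` — from the sub-leaf and
the `K`-rationality of Heegner points ALONE (frame clause (W←)); NO use of the Kriz fact. Hence, in the
kernel: **(ALG) ⟺ `X049HeegnerNonTorsionEvenDiscr`** granted Modularity + Gross 1984 + the Kriz fact
(`krizValue_ne_zero_iff_heegnerNonTorsionEvenDiscr`). READING (the typer's RIGIDITY CAVEAT made a theorem):
because the frame `IsAnticyclotomicLFunction` pins `𝓛` at the Waldspurger point ONLY through the dictionary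
(W→)/(W←) — at EVEN `d_K` Thm. 8.14's `L`-value interpolation is not available and the defining toric period
sums (8.6)/(8.7) are not tree vocabulary — an ALG stub quantified over all frames carries EXACTLY the content of
the sub-leaf: registering «kriz-ramified» with `stub_alg := (ALG)` would be a COSTUME of the sub-leaf (BC3:
no stub may cheaply ⟺ its parent), not a cut with teeth. What would give it teeth: a RIGID frame — typed
Def. 8.5/8.7 values, or clause (V) extended to even `d_K` (Cai–Shu–Tian explicit Waldspurger assembled with
(8.12); unprinted) — so that "corank 1 ⟹ 𝓛(𝐍̌_K) ≠ 0" becomes an Iwasawa-theoretic statement about ONE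
function. Recorded for the planner (TARGET v4 §3 promotion trigger): trigger NOT met by typing (ALG) in this
frame; the sub-leaf itself remains the honest registered-stub candidate on the Heegner half.

PARTITION: none (RANK axis). BSD is not touched by any of this.

References: D. Kriz, Ann. of Math. Studies 212 (2021) Thm. 9.10 (p0227–p0231), Thm. 8.9, Thm. 8.14, §1.3
[Kriz2021]; B. Gross, *Heegner points on X₀(N)* (1984) §§3–4 [Gross1984]; B. Gross, D. Zagier, Invent. Math. 84
(1986) Thm. I.6.3 [GrossZagier1986]; F. Diamond, J. Shurman, GTM 228, Thm. 8.8.3 [DiamondShurman2005];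
J. Coates, Y. Li, Y. Tian, S. Zhai, PLMS 110 (2015) Thm. 1.2 [CoatesLiTianZhai2015]; D. Marcus, *Number Fields*
Ch. 3 Thm. 25 [Marcus2018].
-/

noncomputable section

open scoped Classical

open WeierstrassCurve Literature.NumberTheory Literature.NumberTheory.EllipticCurves
open Literature.NumberTheory.GaloisRepresentations (HeckeCharacter)
open Literature.NumberTheory.EllipticCurves.ModularForms (IsNewformOf exists_isNewformOf)
open Literature.NumberTheory.EllipticCurves.Kriz2021 (IsAnticyclotomicLFunction
  thm910_exists_anticyclotomicLFunction)

namespace Summit.BirchSwinnertonDyer.BirchSwinnertonDyer.Theorems.GoldfeldGoodTwists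

/-! ## §1 The analytic object of «kriz-ramified» exists at every field of the sub-leaf -/

/-- **Modularity of `X₀(49)` read at level `49`**: the newform `f₄₉ ∈ S₂(Γ₀(49))` of `cm7` exists
(`exists_isNewformOf` at the conductor, `N(X₀(49)) = 49` by `conductorNorm_cm7`; the level is transported
in the type of the cusp form by substitution). [cite: DiamondShurman2005, Thm. 8.8.3] -/
theorem exists_isNewformOf_cm7_level_fortyNine (hnf : exists_isNewformOf) :
    ∃ f : CuspForm (CongruenceSubgroup.Gamma0 49) 2, IsNewformOf cm7 f := by
  have key : ∀ {N : ℕ} [NeZero N], cm7.conductorNorm ℤ = N →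
      ∃ f : CuspForm (CongruenceSubgroup.Gamma0 N) 2, IsNewformOf cm7 f := by
    intro N _ hN
    subst hN
    exact hnf cm7
  exact key conductorNorm_cm7

/-- **Kriz's `2`-adic anticyclotomic `L`-function of `f₄₉` over `K` EXISTS at every field of the sub-leaf**:
for `K` imaginary quadratic with `4 ∣ d_K` (`2` ramified: one prime above `2`) and `7` split (strict Heegner
hypothesis for `49`), and `f` the newform of `X₀(49)`, the fact gives SOME frame `𝓛` with
`IsAnticyclotomicLFunction 49 cm7 f 2 K 𝓛` (`p = 2 ∤ 49`, `49 ≥ 4`; `q = 8`, `b = 3` in the book).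
[cite: Kriz2021, Thm. 9.10 (p0227) and Thm. 1.1 at p = 2 (p0032 L33–37)] [cite: Marcus2018, Ch. 3 Thm. 25] -/
theorem exists_krizLFunction_cm7_of_four_dvd_discr (hKriz : thm910_exists_anticyclotomicLFunction)
    {K : Type} [Field K] [NumberField K] (hK : IsImaginaryQuadratic K) (h4 : (4 : ℤ) ∣ NumberField.discr K)
    (hH : SatisfiesHeegnerHypothesis 49 K) (f : CuspForm (CongruenceSubgroup.Gamma0 49) 2)
    (hf : IsNewformOf cm7 f) :
    ∃ 𝓛 : HeckeCharacter K → ℂ_[2], IsAnticyclotomicLFunction 49 cm7 f 2 K 𝓛 :=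
  hKriz.two_of_four_dvd_discr cm7 f hf conductorNorm_cm7 (by norm_num) (by norm_num) hK h4 hH

/-! ## §2 The consumer: the sub-leaf (and the crux BY NAME) from the Kriz fact and the algebraic arrow -/

/-- **THE CONSUMER.** The Heegner sub-leaf `X049HeegnerNonTorsionEvenDiscr` from Modularity (`hnf`: the newform
`f₄₉` exists), Kriz 2021 Thm. 9.10 at `p = 2` ramified (`hKriz`: a frame `𝓛` exists; its clause (W→): `𝓛(𝐍̌_K)
≠ 0 ⟹` every level-`49` Heegner point over `K` is non-torsion) and the ALGEBRAIC arrow `hALG` (OPEN, inline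
binder = the candidate `stub_alg` of line «kriz-ramified»): corank one `⟹ 𝓛(𝐍̌_K) ≠ 0` for every frame.
CONDITIONAL on `hALG`; credits nothing. See §3: in this frame `hALG` is EQUIVALENT to the sub-leaf.
[cite: Kriz2021, Thm. 9.10 (p0227 L19–L29, p0231)] [cite: DiamondShurman2005, Thm. 8.8.3] -/
theorem heegnerNonTorsionEvenDiscr_of_kriz_of_krizValue_ne_zero (hnf : exists_isNewformOf)
    (hKriz : thm910_exists_anticyclotomicLFunction)
    (hALG : ∀ (K : Type) [Field K] [NumberField K], IsImaginaryQuadratic K →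
      (4 : ℤ) ∣ NumberField.discr K → SatisfiesHeegnerHypothesis 49 K →
      ∀ (f : CuspForm (CongruenceSubgroup.Gamma0 49) 2), IsNewformOf cm7 f →
      ∀ (𝓛 : HeckeCharacter K → ℂ_[2]), IsAnticyclotomicLFunction 49 cm7 f 2 K 𝓛 →
        (cm7.baseChange K).selmerCorank 2 = 1 → 𝓛 1 ≠ 0) :
    X049HeegnerNonTorsionEvenDiscr := by
  intro K _ _ hK h4 hH hsel P hP
  obtain ⟨f, hf⟩ := exists_isNewformOf_cm7_level_fortyNine hnf
  obtain ⟨𝓛, h𝓛⟩ := exists_krizLFunction_cm7_of_four_dvd_discr hKriz hK h4 hH f hf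
  exact h𝓛.not_isOfFinAddOrder (hALG K hK h4 hH f hf 𝓛 h𝓛 hsel) hP

/-- **CRUX K12₂″ (route decl, BY NAME) from the Kriz fact, the algebraic arrow and the `7`-non-split half**,
granted Modularity (`hnf`), Coates–Li–Tian–Zhai Thm. 1.2 at `R = 1` (`h12`), Gross–Zagier (`hGZ`), Gross 1984
(`hHP`): §2's consumer fed into c201 g4's `rankOneTwoConverseCMSevenAdditiveTwo_of_heegnerNonTorsion_of_nonHeegnerHalf`.
= the composition `RankOneTwoConverseCMSevenAdditiveTwo_of` of the documented line «kriz-ramified»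
(`lines-g10/K12pp_line_kriz_ramified.lean`) with its `stub_print` discharged by the typed fact and `stub_alg`,
`stub_nonHeegnerHalf` kept as binders. CONDITIONAL on the two open binders; credits nothing.
[cite: Kriz2021, Thm. 9.10 (p0227–p0231)] [cite: CoatesLiTianZhai2015, Thm. 1.2 (p. 359, case r = 0)]
[cite: GrossZagier1986, Thm. I.(6.3) and I.§7] -/
theorem rankOneTwoConverseCMSevenAdditiveTwo_of_kriz_of_krizValue_ne_zero_of_nonHeegnerHalf
    (hnf : exists_isNewformOf) (h12 : CoatesLiTianZhai2015.thm12_fullBSD_twist)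
    (hGZ : ∀ (N : ℕ) [NeZero N] (W : WeierstrassCurve ℚ) (K : Type) [Field K] [NumberField K],
      gross_zagier N W K)
    (hHP : ∀ (W : WeierstrassCurve ℚ) (K : Type) [Field K] [NumberField K], exists_isHeegnerPoint W K)
    (hKriz : thm910_exists_anticyclotomicLFunction)
    (hALG : ∀ (K : Type) [Field K] [NumberField K], IsImaginaryQuadratic K →
      (4 : ℤ) ∣ NumberField.discr K → SatisfiesHeegnerHypothesis 49 K →
      ∀ (f : CuspForm (CongruenceSubgroup.Gamma0 49) 2), IsNewformOf cm7 f →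
      ∀ (𝓛 : HeckeCharacter K → ℂ_[2]), IsAnticyclotomicLFunction 49 cm7 f 2 K 𝓛 →
        (cm7.baseChange K).selmerCorank 2 = 1 → 𝓛 1 ≠ 0)
    (hRest : ∀ (K : Type) [Field K] [NumberField K], IsImaginaryQuadratic K → (4 : ℤ) ∣ NumberField.discr K →
      ¬ SatisfiesHeegnerHypothesis 49 K → (cm7.baseChange K).selmerCorank 2 = 1 → analyticRankEK cm7 K = 1) :
    Summit.BirchSwinnertonDyer.BirchSwinnertonDyer.Theses.GoldfeldAllTwistsTwoConverse.RankOneTwoConverseCMSevenAdditiveTwo :=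
  rankOneTwoConverseCMSevenAdditiveTwo_of_heegnerNonTorsion_of_nonHeegnerHalf hnf h12 hGZ hHP
    (heegnerNonTorsionEvenDiscr_of_kriz_of_krizValue_ne_zero hnf hKriz hALG) hRest

/-! ## §3 The converse: the algebraic arrow FROM the sub-leaf — (ALG) ⟺ sub-leaf in this frame -/

/-- **THE CONVERSE: the algebraic arrow from the sub-leaf and Gross 1984 alone** (NO Kriz fact): at a field of
the sub-leaf with corank one, a level-`49` Heegner point exists (`hHP`, via `N(X₀(49)) = 49`), it is non-torsion
by the sub-leaf, and clause (W←) of ANY frame gives `𝓛(𝐍̌_K) ≠ 0`. So (ALG) is NOT weaker than the sub-leaf.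
[cite: Kriz2021, Thm. 9.10 (p0034 L1, (9.19) p0231) and Def. 8.10 (p0213)] [cite: Gross1984, §§3–4] -/
theorem krizValue_ne_zero_of_heegnerNonTorsionEvenDiscr
    (hHP : ∀ (W : WeierstrassCurve ℚ) (K : Type) [Field K] [NumberField K], exists_isHeegnerPoint W K)
    (hNT : X049HeegnerNonTorsionEvenDiscr) :
    ∀ (K : Type) [Field K] [NumberField K], IsImaginaryQuadratic K →
      (4 : ℤ) ∣ NumberField.discr K → SatisfiesHeegnerHypothesis 49 K →
      ∀ (f : CuspForm (CongruenceSubgroup.Gamma0 49) 2), IsNewformOf cm7 f →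
      ∀ (𝓛 : HeckeCharacter K → ℂ_[2]), IsAnticyclotomicLFunction 49 cm7 f 2 K 𝓛 →
        (cm7.baseChange K).selmerCorank 2 = 1 → 𝓛 1 ≠ 0 := by
  intro K _ _ hK h4 hH f _hf 𝓛 h𝓛 hsel
  haveI : NeZero (cm7.conductorNorm ℤ) := ⟨(cm7.conductorNorm_pos_holds).ne'⟩
  have hH' : SatisfiesHeegnerHypothesis (cm7.conductorNorm ℤ) K := by rw [conductorNorm_cm7]; exact hH
  obtain ⟨P, hP0⟩ := hHP cm7 K hK hH'
  have hP : IsHeegnerPoint 49 cm7 K P := isHeegnerPoint_of_level_eq conductorNorm_cm7 hP0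
  exact h𝓛.apply_one_ne_zero hP (hNT K hK h4 hH hsel P hP)

/-- **(ALG) ⟺ the Heegner sub-leaf**, granted Modularity (`hnf`), Gross 1984 (`hHP`) and the Kriz fact
(`hKriz`, used only for ⟹). The RIGIDITY CAVEAT of the typed frame as a kernel theorem: an algebraic stub
quantified over all Kriz frames is a costume of `X049HeegnerNonTorsionEvenDiscr`, not a proper cut — the
promotion trigger of TARGET v4 §3 for «kriz-ramified» is NOT met by typing (ALG) in this frame.
[cite: Kriz2021, Thm. 9.10 (p0227–p0231)] [cite: Gross1984, §§3–4] [cite: DiamondShurman2005, Thm. 8.8.3] -/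
theorem krizValue_ne_zero_iff_heegnerNonTorsionEvenDiscr (hnf : exists_isNewformOf)
    (hHP : ∀ (W : WeierstrassCurve ℚ) (K : Type) [Field K] [NumberField K], exists_isHeegnerPoint W K)
    (hKriz : thm910_exists_anticyclotomicLFunction) :
    (∀ (K : Type) [Field K] [NumberField K], IsImaginaryQuadratic K →
      (4 : ℤ) ∣ NumberField.discr K → SatisfiesHeegnerHypothesis 49 K →
      ∀ (f : CuspForm (CongruenceSubgroup.Gamma0 49) 2), IsNewformOf cm7 f →
      ∀ (𝓛 : HeckeCharacter K → ℂ_[2]), IsAnticyclotomicLFunction 49 cm7 f 2 K 𝓛 →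
        (cm7.baseChange K).selmerCorank 2 = 1 → 𝓛 1 ≠ 0) ↔
    X049HeegnerNonTorsionEvenDiscr :=
  ⟨heegnerNonTorsionEvenDiscr_of_kriz_of_krizValue_ne_zero hnf hKriz,
    krizValue_ne_zero_of_heegnerNonTorsionEvenDiscr hHP⟩

end Summit.BirchSwinnertonDyer.BirchSwinnertonDyer.Theorems.GoldfeldGoodTwists

end
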